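import Summits.BirchSwinnertonDyer.BirchSwinnertonDyer.Theorems.ManinLocalTwoThreeAtkinLehnerSignNineTwistPair
import Summits.BirchSwinnertonDyer.BirchSwinnertonDyer.Theorems.ManinLocalTwoThreeConwayNortonTwistPairs
import HarnessLib

/-!
# `ε₉ = +1` for BOTH members of a same-conductor `(−3)`-twist pair of elliptic curves at `9 ∥ N` (E-facing corollary)

Summit `BirchSwinnertonDyer`, sub-problem `BirchSwinnertonDyer`, route `ManinLocalTwoThree`; width seat `bsd-line-manin23-p2`
(gen 9), `--supports` the crux C3 `ManinPrimeToThreeAtNine` (stmt-BirchSwinnertonDyer-22968).  Cell `bsd-f2-manin`: the seat's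
gen-8 theorem `atkinLehnerInvolution_nine_eq_self_of_charTwist_isNewform0` («`w₉ = +1` on every same-level `χ₋₃`-twist pair
plane at `9 ∥ N`», from the `A₄`-relation `(w(9)t_{1/3})³ = 729γ₀`) made E-FACING through the gen-9 glue
`f_eq_charTwist_of_isIsogenous_quadraticTwist_negThree` (`W ⊗ (−3) ∼ W′` at a common level `9 ∣ N` ⟹ `f_{W′} = f_W ⊗ (·/3)`):
for modular parametrisation data `D, D′` of `W, W′` at the common level `N = 9M`, `3 ∤ M`, with `9 ∣ N_{W′}` and
`W ⊗ (−3) ∼ W′`, BOTH newforms have Atkin–Lehner sign `+1` at `3`: `atkinLehnerEigenvalueAt D.f 3 = 1 = atkinLehnerEigenvalueAt D′.f 3`.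
This is the «twist keeps the conductor» half of the es/an `9 ∥ N` sign dichotomy (E-es-72 / E-es-72♮, MEMO-an §68:
Kodaira III/III* ↦ `+1`), stated without Kodaira symbols: whenever the `(−3)`-twist of `W` has the same conductor, `w₃(W) = +1`
is impossible to violate — so an optimal `μ₃`-curve with `ε₉ = −1` (E-es-72's census) necessarily has a LEVEL-DROPPING twist.

PROVED here (no `sorry`): `atkinLehnerEigenvalueAt_three_eq_one_of_twistPair` (level `9M`),
**`atkinLehnerEigenvalueAt_three_eq_one_of_isIsogenous_quadraticTwist_negThree`** (conductor-level binders: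
`N_{W′} = N_W`, `9 ∣ N_W`, `27 ∤ N_W`).  BSD is not proved by this; Manin's conjecture is not proved by this.
-/

set_option autoImplicit false
set_option linter.dupNamespace false

noncomputable section

open scoped MatrixGroups ModularForm
open CongruenceSubgroup WeierstrassCurve
open Literature.NumberTheory.EllipticCurves Literature.NumberTheory.EllipticCurves.ModularForms
open Summit.BirchSwinnertonDyer.Rank1Residual.ManinAdditive

namespace Summit.BirchSwinnertonDyer.BirchSwinnertonDyer.Theorems.ManinLocalTwoThree

/-- Level `9M`, `3 ∤ M`: both newforms of a `(−3)`-twist pair of curves at the common level `9M` (`9 ∣ N_{W′}`) have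
`ε₉ = +1`. -/
theorem atkinLehnerEigenvalueAt_three_eq_one_of_twistPair {M : ℕ} [NeZero (9 * M)] (hM : ¬ 3 ∣ M)
    {W W' : WeierstrassCurve ℚ} [W.IsElliptic] [W'.IsElliptic] (D : ModularParametrizationData W (9 * M))
    (D' : ModularParametrizationData W' (9 * M)) (h9W' : 9 ∣ W'.conductorNorm ℤ)
    (hiso : IsIsogenous (W.quadraticTwist ((-3 : ℤ) : ℚ)) W') :
    atkinLehnerEigenvalueAt D.f 3 = 1 ∧ atkinLehnerEigenvalueAt D'.f 3 = 1 := by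
  haveI : Fact (Nat.Prime 3) := ⟨Nat.prime_three⟩
  have h9 : 3 ^ 2 ∣ 9 * M := ⟨M, by norm_num⟩
  have hfg := f_eq_charTwist_of_isIsogenous_quadraticTwist_negThree D D' h9 h9W' hiso
  have hχ := isQuadratic_quadraticChar_ringHomComp 3
  have hprim := isPrimitive_quadraticChar_ringHomComp 3 (by norm_num)
  have hf' : IsNewform0 (charTwist (9 * M) dvd_rfl h9 hχ D.f) := hfg ▸ D'.isNewformOf.1
  have hw : atkinLehnerInvolution (9 * M) 2 9 D.f = D.f :=
    atkinLehnerInvolution_nine_eq_self_of_charTwist_isNewform0 hM hχ hprim h9 D.isNewformOf.1 hf'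
  have hw' : atkinLehnerInvolution (9 * M) 2 9 D'.f = D'.f := by
    rw [hfg]; exact atkinLehnerInvolution_nine_charTwist_eq_self hM hχ hprim h9 D.isNewformOf.1 hf'
  -- `Q₃ = 3 ^ v₃(9M) = 9`
  have hfac : 3 ^ (9 * M).factorization 3 = 9 := by
    have h1 : (9 * M).factorization 3 = 2 := by
      rw [show 9 * M = 3 ^ 2 * M by norm_num, Nat.factorization_mul (by norm_num) (fun h0 => NeZero.ne (9 * M) (by rw [h0, mul_zero])),
        Finsupp.add_apply, Nat.Prime.factorization_pow Nat.prime_three, Finsupp.single_eq_same,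
        Nat.factorization_eq_zero_of_not_dvd hM, add_zero]
    rw [h1]; norm_num
  have hAt : ∀ g : CuspForm (Gamma0 (9 * M)) 2, atkinLehnerInvolutionAt (9 * M) 2 3 g = atkinLehnerInvolution (9 * M) 2 9 g :=
    fun g => by rw [atkinLehnerInvolutionAt_eq (N := 9 * M) (k := 2) hfac]
  constructor
  · exact atkinLehnerEigenvalueAt_eq_of_eq_smul D.isNewformOf.1.ne_zero (ε := 1) (by rw [hAt, hw, one_smul])
  · exact atkinLehnerEigenvalueAt_eq_of_eq_smul D'.isNewformOf.1.ne_zero (ε := 1) (by rw [hAt, hw', one_smul])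

/-- Technical form at two propositionally equal levels. -/
theorem atkinLehnerEigenvalueAt_three_eq_one_of_level_eq {W W' : WeierstrassCurve ℚ} [W.IsElliptic] [W'.IsElliptic]
    {N N' : ℕ} [NeZero N] [NeZero N'] (D : ModularParametrizationData W N) (D' : ModularParametrizationData W' N')
    (hNN' : N' = N) (h9 : 9 ∣ N) (h27 : ¬ 27 ∣ N) (h9W' : 9 ∣ W'.conductorNorm ℤ)
    (hiso : IsIsogenous (W.quadraticTwist ((-3 : ℤ) : ℚ)) W') :
    atkinLehnerEigenvalueAt D.f 3 = 1 ∧ atkinLehnerEigenvalueAt D'.f 3 = 1 := by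
  subst hNN'
  obtain ⟨M, rfl⟩ := h9
  have hM : ¬ 3 ∣ M := fun ⟨k, hk⟩ => h27 ⟨k, by rw [hk]; ring⟩
  exact atkinLehnerEigenvalueAt_three_eq_one_of_twistPair hM D D' h9W' hiso

/-- **`ε₉(f_W) = ε₉(f_{W′}) = +1` for a same-conductor `(−3)`-twist pair at `9 ∥ N`** (conductor-level binders): data `D, D′`
at the conductors, `N_{W′} = N_W`, `9 ∣ N_W`, `27 ∤ N_W`, `W ⊗ (−3) ∼ W′`.  Consequently a curve at `9 ∥ N` with Atkin–Lehner
sign `−1` at `3` has a conductor-dropping `(−3)`-twist. -/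
theorem atkinLehnerEigenvalueAt_three_eq_one_of_isIsogenous_quadraticTwist_negThree {W W' : WeierstrassCurve ℚ}
    [W.IsElliptic] [W'.IsElliptic] [NeZero (W.conductorNorm ℤ)] [NeZero (W'.conductorNorm ℤ)]
    (D : ModularParametrizationData W (W.conductorNorm ℤ)) (D' : ModularParametrizationData W' (W'.conductorNorm ℤ))
    (h9 : 9 ∣ W.conductorNorm ℤ) (h27 : ¬ 27 ∣ W.conductorNorm ℤ) (hN : W'.conductorNorm ℤ = W.conductorNorm ℤ)
    (hiso : IsIsogenous (W.quadraticTwist ((-3 : ℤ) : ℚ)) W') :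
    atkinLehnerEigenvalueAt D.f 3 = 1 ∧ atkinLehnerEigenvalueAt D'.f 3 = 1 :=
  atkinLehnerEigenvalueAt_three_eq_one_of_level_eq D D' hN h9 h27 (by rw [hN]; exact h9) hiso

end Summit.BirchSwinnertonDyer.BirchSwinnertonDyer.Theorems.ManinLocalTwoThree

end
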